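import Summits.AtomisticToContinuum.HydrodynamicLimit.Theorems.AntiMazurCoboundariesCorrectorPressureDecayKiferUniformGibbsGlue
import Summits.AtomisticToContinuum.HydrodynamicLimit.Theorems.AntiMazurCoboundariesCorrectorPressureDecayKiferCanonicalCellInequality
import Summits.AtomisticToContinuum.HydrodynamicLimit.Theorems.AntiMazurCoboundariesCorrectorPressureDecayKiferBlockFreeEntropy

/-!
# The uniform entropy bound, Gibbs-reference form, IS A THEOREM (line `FirstLemma`, crux stmt-AtomisticToContinuum-14135)

Closes the registered stub `stub_tangentEntropyBoundUniformGibbs : TangentEntropyBoundUniformGibbs` of skeleton v12 (…KiferEntropyBoundGibbs.lean:77)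
through the GIBBS ROUTE of lead seat c9: the glue `tangentEntropyBoundUniformGibbs_of_pieces` (…KiferUniformGibbsGlue) fed with the finite-`N`
cell inequality `canonicalCellInequality_holds` (…KiferCanonicalCellInequality) and the thermodynamic step `canonicalBlockFreeEntropy_holds`
(…KiferBlockFreeEntropy). No named fact is used anywhere below this theorem.
-/

noncomputable section

namespace Summit.AtomisticToContinuum.HydrodynamicLimit.Theorems.KiferCompactification

/-- **THE UNIFORM ENTROPY BOUND WITH GIBBS REFERENCE HOLDS** (registered stub `stub_tangentEntropyBoundUniformGibbs` of line `FirstLemma`):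
`h(μ | G) ≤ σ³ · liminf_k KL(Q_k ‖ G_{N_k})/(N_k+1)` for unit-weight tangent states against the translation-invariant Gibbs local limit. -/
theorem stub_tangentEntropyBoundUniformGibbs : TangentEntropyBoundUniformGibbs :=
  tangentEntropyBoundUniformGibbs_of_pieces canonicalCellInequality_holds canonicalBlockFreeEntropy_holds

end Summit.AtomisticToContinuum.HydrodynamicLimit.Theorems.KiferCompactification

end
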